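import Literature.AlgebraicGeometry.ComplexMultiplication.EndomorphismFieldCotangentMultiplicityOne
import Literature.NumberTheory.ComplexMultiplication.CMTypeSignatureGaloisClasses
import HarnessLib

/-!
# The `(r, s)`-signature condition (Kottwitz's determinant condition; Kudla–Rapoport, Howard) on Shimura's pair:
# `charpoly(δu | Lie A) = ∏_{σ ∈ Φ} (X − σ(α)) = (X − ψ(a))^r (X − ψ̄(a))^s` with `(r, s)` the multiplicities of THE type

Topic `Literature/AlgebraicGeometry/ComplexMultiplication` (family `hodge`, lane `lit-hodgefound`; the ALGEBRAIC
carrier `Motives.AbelianVariety ℂ`, Shimura's pairs `(A, ι : F →+* A.endAlgebra)` with `[F : ℚ] = 2 dim A` and THE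
type `Φ = cmTypeOfPair ι hF`).  Sequel of `EndomorphismFieldCotangentEigenforms` (`det δu = ∏ σ(α)`, `tr δu = Σ σ(α)`
on the eigenbasis «`δι(α)ωᵢ = α^{φᵢ}ωᵢ`»), `EndomorphismFieldQuadraticScalarCotangentAction` (scalar action of an
imaginary quadratic `K₀ ≤ F` ⟺ THE type induced from `K₀` ⟹ `A ∼ E^{dim A}`), `EndomorphismFieldCotangentMultiplicityOne`
(p11 g26-#1: multiplicity one ⟺ special element ⟹ `F` CM, `A` simple, Hodge for all powers) and
`NumberTheory/ComplexMultiplication/CMTypeSignatureGaloisClasses` (p11 g26-#2: unbalanced signature ⟹ `ψ(K₀) ⊆ K*`).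
Here the signature is read the way the moduli problems of unitary Shimura varieties READ it: through the
characteristic polynomial of the `K₀`-action on `Lie(A)` — on the algebraic carrier, on the Zariski cotangent space
`𝔪_e/𝔪_e²` (dual to `Lie(A)`, same characteristic polynomial).

PRINTED STATEMENTS.  R. Kottwitz, *Points on some Shimura varieties over finite fields*, JAMS 5 (1992)
[Kottwitz1992], §5, p. 390 (held `paper:doi-10-2307-2152772`, p0018): «We require that the quadruple `(A, λ, i, η̄)`
satisfy the "determinant condition." The Lie algebra `Lie(A)` is a locally free `𝒪_S`-module on which `𝒪_B` acts
[…] the determinant of the `𝒪_S`-linear endomorphism `X₁α₁ + ⋯ + X_tα_t` of `Lie(A)` […] be equal to the polynomial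
`f` […] `V` is isomorphic to `W` if and only if `det_V = det_W`.»  B. Howard, *Complex multiplication cycles and
Kudla–Rapoport divisors*, Ann. of Math. 176 (2012) [Howard2012], §1 (held `paper:arxiv-1303.0545`, p. 3): «We further
require that the action of `𝒪_{K₀}` satisfy the `(r,s)`-signature condition: for any `x ∈ 𝒪_{K₀}`, locally on `S`
the determinant of `T − x` acting on `Lie(A)` is equal to the image of `(T − ι(x))^r (T − ῑ(x))^s ∈ 𝒪_{K₀}[T]`»;
§3.1 (p. 19): «this condition implies that every `x ∈ 𝒪_K` acts on `Lie(A)` with characteristic polynomial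
`∏_{φ ∈ Φ} (T − φ(x)) ∈ 𝒪_Φ[T]`, and in particular, the action of `𝒪_{K₀}` on `A` satisfies the signature
`(n−1,1)`-condition»; §2.4: signature `(n, 0)`.  G. Shimura (1998) [Shimura1998], §5.2, p. 39 (the eigenbasis of
`𝔇₀(A)`).

WHAT IS PROVED (hypotheses `(ιF : F →+* A.endAlgebra) (hF : finrank ℚ F = 2 * A.dim)`, `K₀ : IntermediateField ℚ F`
with `[IsTotallyComplex K₀]`, `finrank ℚ K₀ = 2` where needed; `u : End A` with `1 ⊗ u = ι(a)`; the multiplicity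
`m_ψ = Fintype.card {σ : Φ.1 // σ.1.comp (algebraMap K₀ F) = ψ}` as in the predecessor files):

* §1 **`charpoly_cotangentMap_eq_prod`** — `charpoly(δu) = ∏_{σ ∈ Φ} (X − σ(α))` (Howard's display);
  `charpoly_cotangentMap_eq_prod_pow` (any subfield `K₀`: `∏_ψ (X − ψ(a))^{m_ψ}`); for `K₀` imaginary quadratic
  `card_fibre_add_card_fibre_conjugate_eq_dim` (`r + s = dim A`), **`charpoly_cotangentMap_eq_pow_mul_pow`** — THE
  `(r, s)`-SIGNATURE CONDITION HOLDS WITH `(r, s) = (m_ψ, m_ψ̄)` —, and conversely **`card_fibre_eq_of_charpoly_eq`**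
  («`V ≅ W` iff `det_V = det_W`»: the condition with exponents `(r, s)` forces `(m_ψ, m_ψ̄) = (r, s)`; root count at a
  separating `a`), `forall_charpoly_eq_iff_card_fibre_eq`, `add_eq_dim_of_charpoly_eq`.
* §2 signature `(n, 0)`: **`forall_charpoly_eq_pow_dim_iff_cotangentMap_eq_smul`** (⟺ the scalar action `δu = ψ(a)·1`,
  i.e. THE type induced from `K₀`, `A ∼ E^{dim A}`), `isStablyNondegenerate_of_charpoly_eq_pow_dim`,
  `hodgeConjectureFor_powSucc_of_charpoly_eq_pow_dim`.
* §3 signature `(n − 1, 1)`: **`exists_special_of_charpoly_eq`** / `charpoly_eq_of_special` (⟺ a special element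
  above `ψ`), `isCMField_of_charpoly_eq` (every dimension), and for `dim A ≥ 3`: **`isSimple_of_charpoly_eq`**,
  `isNondegenerate_cmTypeOfPair_of_charpoly_eq`, `isStablyNondegenerate_of_charpoly_eq`,
  **`hodgeConjectureFor_powSucc_of_charpoly_eq`** (THE HODGE CONJECTURE FOR EVERY POWER of the complex points of
  `𝓜_{(n−1,1)}` with complex multiplication by a field of degree `2n` through `K₀`, unconditional),
  `hodgeConjectureFor_of_isIsogenous_powSucc_of_charpoly_eq`.
* §4 (`F` a CM field) **`fieldRange_le_traceField_cmTypeOfPair_of_card_fibre_ne`** /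
  `fieldRange_le_traceField_cmTypeOfPair_of_charpoly_eq` — `r ≠ s ⟹ ψ(K₀) ⊆ K*` (the reflex field of THE type
  contains the imaginary quadratic field, as for the Shimura data of `GU(r, s)`, `r ≠ s`), and
  `card_fibre_eq_card_fibre_conjugate_of_not_le` (`K* ⊉ ψ(K₀)` forces `r = s`).

Theorems only; no definition, no named fact, no `sorry` (net debt 0); axioms `propext`, `Classical.choice`,
`Quot.sound`.

## References
* [Kottwitz1992] R. E. Kottwitz, *Points on some Shimura varieties over finite fields*, J. Amer. Math. Soc. 5 (1992),
  §5 (p. 390, the determinant condition).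
* [Howard2012] B. Howard, *Complex multiplication cycles and Kudla–Rapoport divisors*, Ann. of Math. (2) 176
  (2012), §1 (the `(r,s)`-signature condition), §2.4, §3.1.
* [Shimura1998] G. Shimura, *Abelian Varieties with Complex Multiplication and Modular Functions* (1998), §5.2
  (p. 39), §6.2 Thm. 3, §8.2 Prop. 26, §8.3 Prop. 28, §8.4 (1).
* [Dodson1984] B. Dodson, Trans. AMS 283 (1984), §3.1.1 Theorem.
* [Gordon1999HodgeAVSurvey] B. B. Gordon, *A survey of the Hodge conjecture for abelian varieties* (1999), §3, Thm. 6.4,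
  Def. 7.6, §9.3.
* [vanGeemen1994HodgeAV] B. van Geemen, LNM 1594 (1994), 4.9, Thm. 4.3, Lemma 3.7.

## Provenance

Lane `lit-hodgefound` (HOME `run/shared/lean/pub/lit-hodgefound/`), prover seat `lit-hodgefound-p11` (gen 26),
self-proposed row g26-#3 (INBOX claim 2026-08-27).
-/

noncomputable section

namespace Literature.AlgebraicGeometry.ComplexMultiplication

open scoped Manifold Classical nonZeroDivisors Polynomial
open CategoryTheory NumberField Module Polynomial
open Literature.AlgebraicGeometry.Motives
open Literature.AlgebraicGeometry.HodgeTheory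
open Literature.AlgebraicGeometry.Pohlmann1968 (IsNondegenerate cmTypeRank)
open Literature.NumberTheory.ComplexMultiplication

namespace EndFieldFullDegree

variable {F : Type} [Field F] [NumberField F] {A : AbelianVariety ℂ}
  (ιF : F →+* A.endAlgebra) (hF : finrank ℚ F = 2 * A.dim) (K₀ : IntermediateField ℚ F)

/-! ### §1 The characteristic polynomial of `δu` on `𝔇₀(A)` is `∏_{σ ∈ Φ} (X − σ(α))` -/

/-- **«every `x ∈ 𝒪_K` acts on `Lie(A)` with characteristic polynomial `∏_{φ ∈ Φ} (T − φ(x))`»**, on Shimura's pair: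
for `1 ⊗ u = ι(α)` the characteristic polynomial of `δu` on the cotangent space `𝔪_e/𝔪_e²` (dual to `Lie(A)`, same
characteristic polynomial) is `∏_{σ ∈ Φ} (X − σ(α))`, `Φ = cmTypeOfPair ι hF` — `δu` is diagonal on the eigenbasis
`exists_basis_eigenforms` («`δι(α)ωᵢ = α^{φᵢ}ωᵢ`»). [cite: Howard2012, §3.1 (display before (3.1))] [cite: Shimura1998, §5.2, p. 39] -/
theorem charpoly_cotangentMap_eq_prod {α : F} {u : End A} (hu : AbelianVariety.endAlgebra.of A u = ιF α) :
    (Motives.AbelianVariety.cotangentMap A u).charpoly = ∏ σ : (cmTypeOfPair ιF hF).1, (X - C (σ.1 α : ℂ)) := by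
  obtain ⟨b, hb⟩ := exists_basis_eigenforms ιF hF
  have hM : LinearMap.toMatrix b b (Motives.AbelianVariety.cotangentMap A u) =
      Matrix.diagonal fun σ : (cmTypeOfPair ιF hF).1 ↦ (σ.1 α : ℂ) := by
    ext i j
    rw [LinearMap.toMatrix_apply, hb j α u hu, map_smul, Finsupp.smul_apply, b.repr_self,
      Matrix.diagonal_apply, Finsupp.single_apply, smul_eq_mul, mul_ite, mul_one, mul_zero]
    by_cases h : i = j
    · subst h
      simp
    · rw [if_neg (Ne.symm h), if_neg h]
  rw [← LinearMap.charpoly_toMatrix _ b, hM, Matrix.charpoly_diagonal]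

/-- **Fibrewise form over a subfield `K₀ ≤ F`**: for `a ∈ K₀` with `1 ⊗ u = ι(a)`,
`charpoly(δu) = ∏_ψ (X − ψ(a))^{m_ψ}`, `m_ψ = #{σ ∈ Φ | σ|_{K₀} = ψ}` the multiplicity of the eigencharacter `ψ`
(Kottwitz's determinant condition records exactly these multiplicities: «`V` is isomorphic to `W` if and only if
`det_V = det_W`»). [cite: Kottwitz1992, §5 (p. 390, the determinant condition)] [cite: Howard2012, §1 (the `(r,s)`-signature condition)] -/
theorem charpoly_cotangentMap_eq_prod_pow {a : K₀} {u : End A}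
    (hu : AbelianVariety.endAlgebra.of A u = ιF (algebraMap K₀ F a)) :
    (Motives.AbelianVariety.cotangentMap A u).charpoly =
      ∏ ψ : K₀ →+* ℂ, (X - C (ψ a : ℂ)) ^
        Fintype.card {σ : (cmTypeOfPair ιF hF).1 // σ.1.comp (algebraMap K₀ F) = ψ} := by
  rw [charpoly_cotangentMap_eq_prod ιF hF hu]
  have h := Fintype.prod_fiberwise' (fun σ : (cmTypeOfPair ιF hF).1 ↦ σ.1.comp (algebraMap K₀ F))
    (fun ψ : K₀ →+* ℂ ↦ (X - C (ψ a : ℂ)))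
  simp only [RingHom.comp_apply] at h
  rw [← h]
  refine Finset.prod_congr rfl fun ψ _ ↦ ?_
  rw [Finset.prod_const, Finset.card_univ]

section Quadratic

variable [IsTotallyComplex K₀]

/-- `ψ̄ ≠ ψ`. [folklore] -/
private theorem conjugate_ne' (ψ : K₀ →+* ℂ) : ComplexEmbedding.conjugate ψ ≠ ψ := fun h =>
  IsTotallyComplex.complexEmbedding_not_isReal ψ (ComplexEmbedding.isReal_iff.2 h)

/-- `Hom(K₀, ℂ) = {ψ, ψ̄}` for `[K₀ : ℚ] = 2`. [cite: Shimura1998, §8.4 (1)] -/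
private theorem univ_eq_pair' (hK₀ : finrank ℚ K₀ = 2) (ψ : K₀ →+* ℂ) :
    (Finset.univ : Finset (K₀ →+* ℂ)) = {ψ, ComplexEmbedding.conjugate ψ} := by
  ext χ
  simp only [Finset.mem_univ, Finset.mem_insert, Finset.mem_singleton, true_iff]
  by_contra h
  push Not at h
  have h3 := Fintype.two_lt_card_iff.2 ⟨χ, ψ, ComplexEmbedding.conjugate ψ, h.1, h.2, (conjugate_ne' K₀ ψ).symm⟩
  rw [Embeddings.card, hK₀] at h3
  exact lt_irrefl _ h3

/-- **`r + s = dim A`**: the multiplicities of the two eigencharacters `ψ`, `ψ̄` of the imaginary quadratic `K₀` on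
`𝔇₀(A)` add up to `dim A`. [cite: Howard2012, §1 (`𝓜_{(r,s)}`)] [cite: vanGeemen1994HodgeAV, 4.9] -/
theorem card_fibre_add_card_fibre_conjugate_eq_dim (hK₀ : finrank ℚ K₀ = 2) (ψ : K₀ →+* ℂ) :
    Fintype.card {σ : (cmTypeOfPair ιF hF).1 // σ.1.comp (algebraMap K₀ F) = ψ} +
      Fintype.card {σ : (cmTypeOfPair ιF hF).1 //
        σ.1.comp (algebraMap K₀ F) = ComplexEmbedding.conjugate ψ} = A.dim := by
  have hsum := sum_card_comp_algebraMap_eq_dim ιF hF K₀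
  rwa [univ_eq_pair' K₀ hK₀ ψ, Finset.sum_pair (conjugate_ne' K₀ _).symm] at hsum

/-- **THE `(r, s)`-SIGNATURE CONDITION ON SHIMURA'S PAIR** (Kottwitz's determinant condition for `GU(r, s)`, Kudla–
Rapoport / Howard: «for any `x ∈ 𝒪_{K₀}` … the determinant of `T − x` acting on `Lie(A)` is equal to the image of
`(T − ι(x))^r (T − ῑ(x))^s`»): for `a ∈ K₀`, `1 ⊗ u = ι(a)`, the characteristic polynomial of `δu` on `𝔪_e/𝔪_e²` is
`(X − ψ(a))^r (X − ψ̄(a))^s` with `(r, s) = (m_ψ, m_ψ̄)` THE MULTIPLICITIES READ ON THE TYPE `Φ = cmTypeOfPair ι hF`.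
[cite: Howard2012, §1 (the `(r,s)`-signature condition) and §3.1] [cite: Kottwitz1992, §5 (p. 390)] -/
theorem charpoly_cotangentMap_eq_pow_mul_pow (hK₀ : finrank ℚ K₀ = 2) (ψ : K₀ →+* ℂ) {a : K₀} {u : End A}
    (hu : AbelianVariety.endAlgebra.of A u = ιF (algebraMap K₀ F a)) :
    (Motives.AbelianVariety.cotangentMap A u).charpoly =
      (X - C (ψ a : ℂ)) ^ Fintype.card {σ : (cmTypeOfPair ιF hF).1 // σ.1.comp (algebraMap K₀ F) = ψ} *
        (X - C (ComplexEmbedding.conjugate ψ a : ℂ)) ^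
          Fintype.card {σ : (cmTypeOfPair ιF hF).1 //
            σ.1.comp (algebraMap K₀ F) = ComplexEmbedding.conjugate ψ} := by
  rw [charpoly_cotangentMap_eq_prod_pow ιF hF K₀ hu, univ_eq_pair' K₀ hK₀ ψ, Finset.prod_pair (conjugate_ne' K₀ _).symm]

/-- Root count: in `(X − c)^m (X − d)^{m'}`, `c ≠ d`, the root `c` has multiplicity `m`. [folklore] -/
private theorem count_roots_pow_mul_pow {c d : ℂ} (hcd : c ≠ d) (m m' : ℕ) :
    ((X - C c) ^ m * (X - C d) ^ m').roots.count c = m := by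
  have hne : (X - C c) ^ m * (X - C d) ^ m' ≠ 0 :=
    mul_ne_zero (pow_ne_zero _ (X_sub_C_ne_zero c)) (pow_ne_zero _ (X_sub_C_ne_zero d))
  rw [roots_mul hne, roots_pow, roots_pow, roots_X_sub_C, roots_X_sub_C, Multiset.count_add,
    Multiset.count_nsmul, Multiset.count_nsmul, Multiset.count_singleton_self, Multiset.count_singleton,
    if_neg hcd, mul_one, mul_zero, add_zero]

/-- **The signature condition DETERMINES the multiplicities** («`V ≅ W` iff `det_V = det_W`»): if for every `a ∈ K₀`
and `1 ⊗ u = ι(a)` the characteristic polynomial of `δu` on `𝔪_e/𝔪_e²` is `(X − ψ(a))^r (X − ψ̄(a))^s`, then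
`(r, s) = (m_ψ, m_ψ̄)` — compare the multiplicity of the root `ψ(a)` at an `a` in the order separating `ψ` from `ψ̄`.
[cite: Kottwitz1992, §5 (p. 390)] [cite: Howard2012, §1] -/
theorem card_fibre_eq_of_charpoly_eq (hK₀ : finrank ℚ K₀ = 2) (ψ : K₀ →+* ℂ) {r s : ℕ}
    (h : ∀ (a : K₀) (u : End A), AbelianVariety.endAlgebra.of A u = ιF (algebraMap K₀ F a) →
      (Motives.AbelianVariety.cotangentMap A u).charpoly =
        (X - C (ψ a : ℂ)) ^ r * (X - C (ComplexEmbedding.conjugate ψ a : ℂ)) ^ s) :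
    Fintype.card {σ : (cmTypeOfPair ιF hF).1 // σ.1.comp (algebraMap K₀ F) = ψ} = r ∧
      Fintype.card {σ : (cmTypeOfPair ιF hF).1 //
        σ.1.comp (algebraMap K₀ F) = ComplexEmbedding.conjugate ψ} = s := by
  -- an element of the order separating `ψ` from `ψ̄`
  obtain ⟨a₀, ha₀⟩ : ∃ a₀ : K₀, ComplexEmbedding.conjugate ψ a₀ ≠ ψ a₀ := by
    by_contra hno
    push Not at hno
    exact conjugate_ne' K₀ ψ (RingHom.ext hno)
  obtain ⟨M, u, hM, hu⟩ := exists_of_eq_natCast_mul ιF (algebraMap K₀ F a₀)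
  have hu' : AbelianVariety.endAlgebra.of A u = ιF (algebraMap K₀ F ((M : K₀) * a₀)) := by
    rw [map_mul, map_natCast]; exact hu
  have hne : (ψ ((M : K₀) * a₀) : ℂ) ≠ ComplexEmbedding.conjugate ψ ((M : K₀) * a₀) := by
    rw [map_mul, map_mul, map_natCast, map_natCast]
    exact fun h' => ha₀.symm (mul_left_cancel₀ (Nat.cast_ne_zero.2 hM) h')
  have key := (charpoly_cotangentMap_eq_pow_mul_pow ιF hF K₀ hK₀ ψ hu').symm.trans (h _ u hu')
  constructor
  · have h1 := congrArg (fun p : ℂ[X] => p.roots.count (ψ ((M : K₀) * a₀) : ℂ)) key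
    simp only [count_roots_pow_mul_pow hne] at h1
    exact h1
  · have h1 := congrArg (fun p : ℂ[X] => p.roots.count (ComplexEmbedding.conjugate ψ ((M : K₀) * a₀) : ℂ)) key
    simp only [mul_comm ((X - C (ψ ((M : K₀) * a₀) : ℂ)) ^ _), count_roots_pow_mul_pow hne.symm] at h1
    exact h1

/-- **Equivalent readings of the signature `(r, s)`**: the `(r, s)`-signature condition on every `δu`, `a ∈ K₀`,
holds iff `(m_ψ, m_ψ̄) = (r, s)`. [cite: Kottwitz1992, §5 (p. 390)] [cite: Howard2012, §1] -/
theorem forall_charpoly_eq_iff_card_fibre_eq (hK₀ : finrank ℚ K₀ = 2) (ψ : K₀ →+* ℂ) (r s : ℕ) :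
    (∀ (a : K₀) (u : End A), AbelianVariety.endAlgebra.of A u = ιF (algebraMap K₀ F a) →
      (Motives.AbelianVariety.cotangentMap A u).charpoly =
        (X - C (ψ a : ℂ)) ^ r * (X - C (ComplexEmbedding.conjugate ψ a : ℂ)) ^ s) ↔
    Fintype.card {σ : (cmTypeOfPair ιF hF).1 // σ.1.comp (algebraMap K₀ F) = ψ} = r ∧
      Fintype.card {σ : (cmTypeOfPair ιF hF).1 //
        σ.1.comp (algebraMap K₀ F) = ComplexEmbedding.conjugate ψ} = s := by
  refine ⟨card_fibre_eq_of_charpoly_eq ιF hF K₀ hK₀ ψ, ?_⟩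
  rintro ⟨rfl, rfl⟩ a u hu
  exact charpoly_cotangentMap_eq_pow_mul_pow ιF hF K₀ hK₀ ψ hu

include hF in
/-- The signature condition can only hold with `r + s = dim A`. [cite: Howard2012, §1] -/
theorem add_eq_dim_of_charpoly_eq (hK₀ : finrank ℚ K₀ = 2) (ψ : K₀ →+* ℂ) {r s : ℕ}
    (h : ∀ (a : K₀) (u : End A), AbelianVariety.endAlgebra.of A u = ιF (algebraMap K₀ F a) →
      (Motives.AbelianVariety.cotangentMap A u).charpoly =
        (X - C (ψ a : ℂ)) ^ r * (X - C (ComplexEmbedding.conjugate ψ a : ℂ)) ^ s) :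
    r + s = A.dim := by
  obtain ⟨h1, h2⟩ := card_fibre_eq_of_charpoly_eq ιF hF K₀ hK₀ ψ h
  rw [← h1, ← h2]
  exact card_fibre_add_card_fibre_conjugate_eq_dim ιF hF K₀ hK₀ ψ

/-! ### §2 Signature `(n, 0)`: the scalar case — `A ∼ E^{dim A}` -/

include hF in
/-- **The `(n, 0)`-signature condition is the scalar action of `K₀` on `𝔇₀(A)`** (`δu = ψ(a)·1`), i.e. THE type is
induced from the CM type `{ψ}` of `K₀` and `A ∼ E^{dim A}` (`EndomorphismFieldQuadraticScalarCotangentAction`).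
[cite: Howard2012, §2.4 (signature `(n, 0)`)] [cite: Shimura1998, §6.2 (proof of Thm. 3), p. 43] -/
theorem forall_charpoly_eq_pow_dim_iff_cotangentMap_eq_smul (hK₀ : finrank ℚ K₀ = 2) (ψ : K₀ →+* ℂ) :
    (∀ (a : K₀) (u : End A), AbelianVariety.endAlgebra.of A u = ιF (algebraMap K₀ F a) →
      (Motives.AbelianVariety.cotangentMap A u).charpoly = (X - C (ψ a : ℂ)) ^ A.dim) ↔
    ∀ (a : K₀) (u : End A), AbelianVariety.endAlgebra.of A u = ιF (algebraMap K₀ F a) →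
      Motives.AbelianVariety.cotangentMap A u = (ψ a : ℂ) • LinearMap.id := by
  rw [← forall_comp_algebraMap_eq_iff_cotangentMap_eq_smul ιF hF K₀ ψ]
  have hiff := forall_charpoly_eq_iff_card_fibre_eq ιF hF K₀ hK₀ ψ A.dim 0
  simp only [pow_zero, mul_one] at hiff
  rw [hiff]
  have hsum := card_fibre_add_card_fibre_conjugate_eq_dim ιF hF K₀ hK₀ ψ
  constructor
  · rintro ⟨-, h0⟩ φ hφ
    by_contra hne
    have hmem : φ.comp (algebraMap K₀ F) = ComplexEmbedding.conjugate ψ := by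
      have huniv := univ_eq_pair' K₀ hK₀ ψ
      have hχ : φ.comp (algebraMap K₀ F) ∈ (Finset.univ : Finset (K₀ →+* ℂ)) := Finset.mem_univ _
      rw [huniv, Finset.mem_insert, Finset.mem_singleton] at hχ
      exact hχ.resolve_left hne
    have hpos : 0 < Fintype.card {σ : (cmTypeOfPair ιF hF).1 //
        σ.1.comp (algebraMap K₀ F) = ComplexEmbedding.conjugate ψ} :=
      Fintype.card_pos_iff.2 ⟨⟨⟨φ, hφ⟩, hmem⟩⟩
    omega
  · intro h
    have h0 : Fintype.card {σ : (cmTypeOfPair ιF hF).1 //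
        σ.1.comp (algebraMap K₀ F) = ComplexEmbedding.conjugate ψ} = 0 := by
      rw [Fintype.card_eq_zero_iff]
      refine ⟨fun σ => conjugate_ne' K₀ ψ ?_⟩
      rw [← σ.2, h σ.1.1 σ.1.2]
    constructor <;> omega

include hF in
/-- **Signature `(n, 0)` ⟹ `Hdg(Aᵏ) = Div(Aᵏ)` for all `k` and the Hodge conjecture for every power of `A`**
(`A ∼ E^{dim A}`). [cite: Gordon1999HodgeAVSurvey, §3 Theorem and Def. 7.6] [cite: Shimura1998, §6.2 Thm. 3] -/
theorem isStablyNondegenerate_of_charpoly_eq_pow_dim (hK₀ : finrank ℚ K₀ = 2) (ψ : K₀ →+* ℂ)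
    (h : ∀ (a : K₀) (u : End A), AbelianVariety.endAlgebra.of A u = ιF (algebraMap K₀ F a) →
      (Motives.AbelianVariety.cotangentMap A u).charpoly = (X - C (ψ a : ℂ)) ^ A.dim) :
    IsStablyNondegenerate A := by
  have hall := (forall_comp_algebraMap_eq_iff_cotangentMap_eq_smul ιF hF K₀ ψ).2
    ((forall_charpoly_eq_pow_dim_iff_cotangentMap_eq_smul ιF hF K₀ hK₀ ψ).1 h)
  exact isStablyNondegenerate_of_forall_comp_eq ιF hF hK₀ fun φ hφ χ hχ => by rw [hall φ hφ, hall χ hχ]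

include hF in
/-- The Hodge conjecture for every power of `A` under the `(n, 0)`-signature condition.
[cite: Gordon1999HodgeAVSurvey, §3 Theorem] [cite: vanGeemen1994HodgeAV, Thm. 4.3] -/
theorem hodgeConjectureFor_powSucc_of_charpoly_eq_pow_dim (hK₀ : finrank ℚ K₀ = 2) (ψ : K₀ →+* ℂ)
    (h : ∀ (a : K₀) (u : End A), AbelianVariety.endAlgebra.of A u = ιF (algebraMap K₀ F a) →
      (Motives.AbelianVariety.cotangentMap A u).charpoly = (X - C (ψ a : ℂ)) ^ A.dim) (N : ℕ) :
    HodgeConjectureFor (A.powSucc N).dim (A.powSucc N).X :=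
  (isStablyNondegenerate_of_charpoly_eq_pow_dim ιF hF K₀ hK₀ ψ h).hodgeConjectureFor_powSucc N

/-! ### §3 Signature `(n − 1, 1)`: the special element — `F` CM, `A` simple, the Hodge conjecture for all powers -/

/-- **The `(1, n − 1)`-signature condition over `ψ` (equivalently `(n − 1, 1)` over `ψ̄`) gives THE type a special
element above `ψ`.** [cite: Howard2012, §1 and §3.1] [cite: Kottwitz1992, §5 (p. 390)] -/
theorem exists_special_of_charpoly_eq (hK₀ : finrank ℚ K₀ = 2) (ψ : K₀ →+* ℂ)
    (h : ∀ (a : K₀) (u : End A), AbelianVariety.endAlgebra.of A u = ιF (algebraMap K₀ F a) →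
      (Motives.AbelianVariety.cotangentMap A u).charpoly =
        (X - C (ψ a : ℂ)) ^ 1 * (X - C (ComplexEmbedding.conjugate ψ a : ℂ)) ^ (A.dim - 1)) :
    ∃ σ₀ ∈ (cmTypeOfPair ιF hF).1, σ₀.comp (algebraMap K₀ F) = ψ ∧
      ∀ φ ∈ (cmTypeOfPair ιF hF).1, φ.comp (algebraMap K₀ F) = σ₀.comp (algebraMap K₀ F) → φ = σ₀ :=
  exists_special_of_card_fibre_eq_one ιF hF K₀ (card_fibre_eq_of_charpoly_eq ιF hF K₀ hK₀ ψ h).1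

/-- Conversely a special element above `ψ` gives the `(1, n − 1)`-signature condition. [cite: Howard2012, §1 and §3.1] -/
theorem charpoly_eq_of_special (hK₀ : finrank ℚ K₀ = 2) {σ₀ : F →+* ℂ} (hσ₀ : σ₀ ∈ (cmTypeOfPair ιF hF).1)
    (hsp : ∀ φ ∈ (cmTypeOfPair ιF hF).1, φ.comp (algebraMap K₀ F) = σ₀.comp (algebraMap K₀ F) → φ = σ₀)
    {a : K₀} {u : End A} (hu : AbelianVariety.endAlgebra.of A u = ιF (algebraMap K₀ F a)) :
    (Motives.AbelianVariety.cotangentMap A u).charpoly =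
      (X - C (σ₀ (algebraMap K₀ F a) : ℂ)) *
        (X - C (ComplexEmbedding.conjugate (σ₀.comp (algebraMap K₀ F)) a : ℂ)) ^ (A.dim - 1) := by
  rw [charpoly_cotangentMap_eq_pow_mul_pow ιF hF K₀ hK₀ (σ₀.comp (algebraMap K₀ F)) hu,
    card_fibre_eq_one_of_special ιF hF K₀ hσ₀ hsp, card_fibre_conjugate_eq_of_special ιF hF K₀ hK₀ hσ₀ hsp, pow_one,
    RingHom.comp_apply]

include hF in
/-- **The `(n − 1, 1)`-signature condition forces `F` to be a CM field** (every dimension).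
[cite: Howard2012, §1 and §3.1] [cite: Shimura1998, §5.2 Thm. 1; §18.2 Lemma (ii)] -/
theorem isCMField_of_charpoly_eq (hK₀ : finrank ℚ K₀ = 2) (ψ : K₀ →+* ℂ)
    (h : ∀ (a : K₀) (u : End A), AbelianVariety.endAlgebra.of A u = ιF (algebraMap K₀ F a) →
      (Motives.AbelianVariety.cotangentMap A u).charpoly =
        (X - C (ψ a : ℂ)) ^ 1 * (X - C (ComplexEmbedding.conjugate ψ a : ℂ)) ^ (A.dim - 1)) : IsCMField F := by
  obtain ⟨σ₀, hσ₀, -, hsp⟩ := exists_special_of_charpoly_eq ιF hF K₀ hK₀ ψ h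
  exact isCMField_of_special ιF hF K₀ hK₀ hσ₀ hsp

variable (h3 : 3 ≤ A.dim)
include h3

include hF in
/-- **The `(n − 1, 1)`-signature condition, `n = dim A ≥ 3`, forces `A` SIMPLE.** [cite: Howard2012, §1 and §3.1]
[cite: Shimura1998, §8.2 Prop. 26] -/
theorem isSimple_of_charpoly_eq (hK₀ : finrank ℚ K₀ = 2) (ψ : K₀ →+* ℂ)
    (h : ∀ (a : K₀) (u : End A), AbelianVariety.endAlgebra.of A u = ιF (algebraMap K₀ F a) →
      (Motives.AbelianVariety.cotangentMap A u).charpoly =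
        (X - C (ψ a : ℂ)) ^ 1 * (X - C (ComplexEmbedding.conjugate ψ a : ℂ)) ^ (A.dim - 1)) :
    AbelianVariety.IsSimple A := by
  obtain ⟨σ₀, hσ₀, -, hsp⟩ := exists_special_of_charpoly_eq ιF hF K₀ hK₀ ψ h
  exact isSimple_of_special ιF hF K₀ hK₀ h3 hσ₀ hsp

/-- **… and THE type nondegenerate**, `Rank = dim A + 1`. [cite: Dodson1984, §3.1.1 Theorem] [cite: Howard2012, §3.1] -/
theorem isNondegenerate_cmTypeOfPair_of_charpoly_eq (hK₀ : finrank ℚ K₀ = 2) (ψ : K₀ →+* ℂ)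
    (h : ∀ (a : K₀) (u : End A), AbelianVariety.endAlgebra.of A u = ιF (algebraMap K₀ F a) →
      (Motives.AbelianVariety.cotangentMap A u).charpoly =
        (X - C (ψ a : ℂ)) ^ 1 * (X - C (ComplexEmbedding.conjugate ψ a : ℂ)) ^ (A.dim - 1)) :
    IsNondegenerate (cmTypeOfPair ιF hF) := by
  obtain ⟨σ₀, hσ₀, -, hsp⟩ := exists_special_of_charpoly_eq ιF hF K₀ hK₀ ψ h
  exact isNondegenerate_cmTypeOfPair_of_special ιF hF K₀ hK₀ h3 hσ₀ hsp

include hF in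
/-- **… `Hdg(Aᵏ) = Div(Aᵏ)` for all `k`.** [cite: Gordon1999HodgeAVSurvey, Thm. 6.4 and §9.3] [cite: Dodson1984, §3.1.1 Theorem] -/
theorem isStablyNondegenerate_of_charpoly_eq (hK₀ : finrank ℚ K₀ = 2) (ψ : K₀ →+* ℂ)
    (h : ∀ (a : K₀) (u : End A), AbelianVariety.endAlgebra.of A u = ιF (algebraMap K₀ F a) →
      (Motives.AbelianVariety.cotangentMap A u).charpoly =
        (X - C (ψ a : ℂ)) ^ 1 * (X - C (ComplexEmbedding.conjugate ψ a : ℂ)) ^ (A.dim - 1)) :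
    IsStablyNondegenerate A := by
  obtain ⟨σ₀, hσ₀, -, hsp⟩ := exists_special_of_charpoly_eq ιF hF K₀ hK₀ ψ h
  exact isStablyNondegenerate_of_special ιF hF K₀ hK₀ h3 hσ₀ hsp

include hF in
/-- **THE HODGE CONJECTURE FOR EVERY POWER OF `A` UNDER THE `(n − 1, 1)`-SIGNATURE CONDITION** (`dim A ≥ 3`): the
complex points of Kudla–Rapoport's `𝓜_{(n−1,1)}` carrying complex multiplication by a field of degree `2n` through
`K₀` satisfy the Hodge conjecture together with all their powers, unconditionally.
[cite: Gordon1999HodgeAVSurvey, Thm. 6.4 and §9.3] [cite: Dodson1984, §3.1.1 Theorem] [cite: Howard2012, §1 and §3.1] -/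
theorem hodgeConjectureFor_powSucc_of_charpoly_eq (hK₀ : finrank ℚ K₀ = 2) (ψ : K₀ →+* ℂ)
    (h : ∀ (a : K₀) (u : End A), AbelianVariety.endAlgebra.of A u = ιF (algebraMap K₀ F a) →
      (Motives.AbelianVariety.cotangentMap A u).charpoly =
        (X - C (ψ a : ℂ)) ^ 1 * (X - C (ComplexEmbedding.conjugate ψ a : ℂ)) ^ (A.dim - 1)) (N : ℕ) :
    HodgeConjectureFor (A.powSucc N).dim (A.powSucc N).X :=
  (isStablyNondegenerate_of_charpoly_eq ιF hF K₀ h3 hK₀ ψ h).hodgeConjectureFor_powSucc N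

include hF in
/-- … and for everything isogenous to a power of `A`. [cite: vanGeemen1994HodgeAV, Lemma 3.7]
[cite: Gordon1999HodgeAVSurvey, Thm. 6.4 and §9.3] -/
theorem hodgeConjectureFor_of_isIsogenous_powSucc_of_charpoly_eq (hK₀ : finrank ℚ K₀ = 2) (ψ : K₀ →+* ℂ)
    (h : ∀ (a : K₀) (u : End A), AbelianVariety.endAlgebra.of A u = ιF (algebraMap K₀ F a) →
      (Motives.AbelianVariety.cotangentMap A u).charpoly =
        (X - C (ψ a : ℂ)) ^ 1 * (X - C (ComplexEmbedding.conjugate ψ a : ℂ)) ^ (A.dim - 1))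
    {X' : AbelianVariety ℂ} {N : ℕ} (hX : X'.IsIsogenous (A.powSucc N)) : HodgeConjectureFor X'.dim X'.X :=
  (isStablyNondegenerate_of_charpoly_eq ιF hF K₀ h3 hK₀ ψ h).hodgeConjectureFor_of_isIsogenous_powSucc hX

end Quadratic

/-! ### §4 Unbalanced signature: the reflex field of THE type contains `ψ(K₀)` -/

section Reflex

/-- The multiplicity `m_ψ` as a set cardinality (the spelling of `CMTypeSignatureGaloisClasses`). [folklore] -/
private theorem ncard_inter_fibre_eq_card_fibre (ψ : K₀ →+* ℂ) :
    {φ : F →+* ℂ | φ ∈ (cmTypeOfPair ιF hF).1 ∧ φ.comp (algebraMap K₀ F) = ψ}.ncard =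
      Fintype.card {σ : (cmTypeOfPair ιF hF).1 // σ.1.comp (algebraMap K₀ F) = ψ} := by
  rw [← Nat.card_coe_set_eq, Fintype.card_eq_nat_card]
  exact Nat.card_congr
    (Equiv.subtypeSubtypeEquivSubtypeInter (fun φ : F →+* ℂ => φ ∈ (cmTypeOfPair ιF hF).1)
      (fun φ => φ.comp (algebraMap K₀ F) = ψ)).symm

include hF in
/-- `[F : K₀] = dim A`. [folklore] -/
private theorem finrank_eq_dim (hK₀ : finrank ℚ K₀ = 2) : finrank K₀ F = A.dim := by
  have h := Module.finrank_mul_finrank ℚ K₀ F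
  rw [hK₀, hF] at h
  omega

variable [IsTotallyComplex K₀] [IsCMField F]

/-- **UNBALANCED SIGNATURE `r ≠ s` ⟹ THE REFLEX FIELD OF THE TYPE CONTAINS `ψ(K₀)`** (for `F` a CM field): an
automorphism of `ℂ` fixing `K* = ℚ(tr_Φ)` fixes `Φ` and so preserves the multiplicities; it cannot swap `ψ` and `ψ̄`
(`CMTypeSignatureGaloisClasses.fieldRange_le_traceField_of_two_mul_ncard_ne`).  For the unitary Shimura data of
signature `(r, s)`, `r ≠ s`, this is the familiar «the reflex field contains `K₀`».
[cite: Dodson1984, §3.1.1 Theorem (proof, p. 12)] [cite: Howard2012, §3.1 («`K_Φ ⊃ K₀`»)] [cite: Shimura1998, §8.3 Prop. 28] -/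
theorem fieldRange_le_traceField_cmTypeOfPair_of_card_fibre_ne (hK₀ : finrank ℚ K₀ = 2) (ψ : K₀ →+* ℂ)
    (h : Fintype.card {σ : (cmTypeOfPair ιF hF).1 // σ.1.comp (algebraMap K₀ F) = ψ} ≠
      Fintype.card {σ : (cmTypeOfPair ιF hF).1 // σ.1.comp (algebraMap K₀ F) = ComplexEmbedding.conjugate ψ}) :
    ψ.toRatAlgHom.fieldRange ≤ traceField (cmTypeOfPair ιF hF) := by
  refine fieldRange_le_traceField_of_two_mul_ncard_ne K₀ hK₀ (cmTypeOfPair ιF hF) ψ ?_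
  rw [ncard_inter_fibre_eq_card_fibre ιF hF K₀ ψ, finrank_eq_dim hF K₀ hK₀,
    ← card_fibre_add_card_fibre_conjugate_eq_dim ιF hF K₀ hK₀ ψ]
  omega

/-- **The `(r, s)`-signature condition with `r ≠ s` puts `ψ(K₀)` inside the reflex field of THE type.**
[cite: Howard2012, §1 and §3.1] [cite: Dodson1984, §3.1.1 Theorem (proof)] [cite: Shimura1998, §8.3 Prop. 28] -/
theorem fieldRange_le_traceField_cmTypeOfPair_of_charpoly_eq (hK₀ : finrank ℚ K₀ = 2) (ψ : K₀ →+* ℂ) {r s : ℕ}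
    (hrs : r ≠ s)
    (h : ∀ (a : K₀) (u : End A), AbelianVariety.endAlgebra.of A u = ιF (algebraMap K₀ F a) →
      (Motives.AbelianVariety.cotangentMap A u).charpoly =
        (X - C (ψ a : ℂ)) ^ r * (X - C (ComplexEmbedding.conjugate ψ a : ℂ)) ^ s) :
    ψ.toRatAlgHom.fieldRange ≤ traceField (cmTypeOfPair ιF hF) := by
  obtain ⟨h1, h2⟩ := card_fibre_eq_of_charpoly_eq ιF hF K₀ hK₀ ψ h
  exact fieldRange_le_traceField_cmTypeOfPair_of_card_fibre_ne ιF hF K₀ hK₀ ψ (by rw [h1, h2]; exact hrs)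

/-- **Conversely, if the reflex field of THE type misses `ψ(K₀)` then the signature is BALANCED**, `r = s`,
`dim A = 2r` («Weil type» relative to `K₀`). [cite: Dodson1984, §3.1.1 Theorem (proof)] [cite: Shimura1998, §8.3 Prop. 28] -/
theorem card_fibre_eq_card_fibre_conjugate_of_not_le (hK₀ : finrank ℚ K₀ = 2) (ψ : K₀ →+* ℂ)
    (h : ¬ ψ.toRatAlgHom.fieldRange ≤ traceField (cmTypeOfPair ιF hF)) :
    Fintype.card {σ : (cmTypeOfPair ιF hF).1 // σ.1.comp (algebraMap K₀ F) = ψ} =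
      Fintype.card {σ : (cmTypeOfPair ιF hF).1 // σ.1.comp (algebraMap K₀ F) = ComplexEmbedding.conjugate ψ} := by
  by_contra hne
  exact h (fieldRange_le_traceField_cmTypeOfPair_of_card_fibre_ne ιF hF K₀ hK₀ ψ hne)

end Reflex

end EndFieldFullDegree

end Literature.AlgebraicGeometry.ComplexMultiplication

end
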